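import Summits.BirchSwinnertonDyer.BirchSwinnertonDyer.Theorems.AlignedTransportAtTwoMainConjectureOfRankZeroBSDAtTwoHalfDescentValues
import HarnessLib

/-!
# Route `AlignedTransportAtTwo`, crux C2 `MainConjectureOfRankZeroBSDAtTwo` (stmt-BirchSwinnertonDyer-22298):
# KATO IN HALF-DEGREE COORDINATES, I — the Goresky–Tai transform `h ↦ xⁿh(x + q/x)` RESPECTS AND REFLECTS DIVISIBILITY;
# the twist-zero form `(T+2)^k·(1+T)^m·h(γ + γ⁻¹)` does too (pure polynomial algebra, any commutative ring / any domain)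

HONEST FRAMING (cell `bsd-f1-sign2`, WIDTH-5 attached prover seat `bsd-line-att-p5` gen 52 on line `birth` of the lead `bsd-line-att-p2`;
`--supports` stmt-BirchSwinnertonDyer-22298, closes nothing; BSD is NOT proved by any of this; the crux C2, its verdict «blocked-on
`Rank1Residual.GreenbergMuConjectureIrreducible`» and every registered stub (P / T / Kμ / LimDoor / MuIneqʳ / PFμ⁺) are untouched). THEOREMS ONLY —
pure polynomial algebra; no `def`, no instance, no named fact, no `sorry`. Lineage glue on g51's successor (ii′) «Kato in coordinates»: g51
(`…HalfDescent`, `…HalfDescentTwistZero`) wrote the distinguished polynomial of an `ι`-stable `F ∈ Λ` as `P_F = (T+2)^k·𝒯'_m(h)`,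
`𝒯'_m(h)(T) = ∑ b_j(1+T)^{m−j}((1+T)²+1)^j = (1+T)^m·h(γ + γ⁻¹)`, `k = ord_{T=−2}P_F`, `h ∈ ℤ_p[Y]` monic of degree `m`. Kato's theorem at `2`
is a one-sided divisibility `char X ∣ 2^a·L`, i.e. (sequel `…HalfDescentKato`) `P_{alg} ∣ P_{an}` in `ℤ₂[T]`. THIS FILE supplies the polynomial
algebra that turns `P_F ∣ P_G` into **`h_F ∣ h_G` in `ℤ_p[Y]`** and `k_F ≤ k_G`:
* §1 (any commutative ring `R`, `q` a non-zero-divisor; `𝒯_{q,n}(h) = ∑_{j ≤ n} b_j X^{n−j}(X²+q)^j`, the tree's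
  `Literature.Algebra.Polynomial.QPalindromicRealCounterpart`): `transform_dvd_transform_of_dvd` (multiplicativity), ★★ **`dvd_of_transform_dvd_transform`**
  (`h₁` monic of degree `n₁`, `deg h₂ ≤ n₂`: **`𝒯_{n₁}(h₁) ∣ 𝒯_{n₂}(h₂) ⟹ h₁ ∣ h₂`** — the factor of a `q`-palindromic polynomial complementary to a
  MONIC `q`-palindromic factor is `q`-palindromic (Goresky–Tai's Lemma 37 run backwards: cancel `q^{n₁}𝒯(h₁)` from the two reflection identities),
  hence itself a transform, and `𝒯` is injective), ★★ `transform_dvd_transform_iff`. For Weil `q`-polynomials this is the statement that the real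
  Weil polynomial (Howe–Lauter) of an isogeny factor divides the real Weil polynomial.
* §2 (any domain; the Iwasawa variable `T = X − 1`, `q = 1`): `twistForm_comp_X_sub_one` / `transform_comp_X_add_one` (change of variable),
  `eval_neg_two_twistForm` (`𝒯'_m(h)(−2) = (−1)^m h(−2)`), `monic_twistForm`; ★★ **`dvd_of_twistZero_mul_dvd`**: `h_i` monic, `h₁(−2) ≠ 0`,
  **`(T+2)^{k₁}𝒯'(h₁) ∣ (T+2)^{k₂}𝒯'(h₂) ⟹ h₁ ∣ h₂`** and `k₁ ≤ k₂ + ord_{−2}𝒯'(h₂)` (compare orders at `−2`, peel the excess `(T+2)`-power off the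
  cofactor, cancel, apply §1); `dvd_and_le_of_twistZero_mul_dvd` (both normalised: `k₁ ≤ k₂`); converse `twistZero_mul_dvd_of_dvd`.
Memo `Cruxes/MainConjectureOfRankZeroBSDAtTwo/KATO-COORDINATES-att-p5-g52.md`. BSD is not proved by any of this; nothing about any curve is asserted here.

References: M. Goresky, Y.-S. Tai, arXiv:1701.07742, App. §16.2 Prop. 36 and Lemma 37 [GoreskyTai2017RealStructuresOrdinary]; E. Howe, K. Lauter,
Ann. Inst. Fourier 53 (2003) §3 (the real Weil polynomial; context only); B. Mazur, J. Tate, J. Teitelbaum, Invent. Math. 84 (1986) Ch. I §17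
[MazurTateTeitelbaum1986Invent].
-/

set_option linter.dupNamespace false
set_option autoImplicit false

noncomputable section

open scoped Classical nonZeroDivisors

namespace Summit.BirchSwinnertonDyer.BirchSwinnertonDyer.Theorems.AlignedTransportAtTwoHalfDescentDivisibility

open Literature.Algebra.Polynomial.QPalindromicRealCounterpart

/-! ## §1 The transform respects and reflects divisibility (any commutative ring, `q` a non-zero-divisor) -/

section Transform

open Polynomial

variable {R : Type*} [CommRing R]

/-- **`𝒯` respects divisibility**: `h₁` monic of degree `n₁`, `deg h₂ ≤ n₂`, `n₁ ≤ n₂`, `h₁ ∣ h₂` ⟹ `𝒯_{q,n₁}(h₁) ∣ 𝒯_{q,n₂}(h₂)`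
(multiplicativity `𝒯_{n₁+c}(h₁r) = 𝒯_{n₁}(h₁)·𝒯_c(r)`). [cite: GoreskyTai2017RealStructuresOrdinary, App. §16.2 Prop. 36 and proof of Lemma 37 (p0036–p0037)] -/
theorem transform_dvd_transform_of_dvd (q : R) {n₁ n₂ : ℕ} {h₁ h₂ : R[X]} (hm₁ : h₁.Monic) (hd₁ : h₁.natDegree = n₁)
    (hn₂ : h₂.natDegree ≤ n₂) (hle : n₁ ≤ n₂) (hdvd : h₁ ∣ h₂) :
    (∑ j ∈ Finset.range (n₁ + 1), C (h₁.coeff j) * X ^ (n₁ - j) * (X ^ 2 + C q) ^ j) ∣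
      ∑ j ∈ Finset.range (n₂ + 1), C (h₂.coeff j) * X ^ (n₂ - j) * (X ^ 2 + C q) ^ j := by
  obtain ⟨c, rfl⟩ := Nat.exists_eq_add_of_le hle
  obtain ⟨r, rfl⟩ := hdvd
  by_cases hr : r = 0
  · subst hr
    rw [mul_zero, transform_zero]
    exact dvd_zero _
  have hdeg : (h₁ * r).natDegree = n₁ + r.natDegree := by rw [hm₁.natDegree_mul' hr, hd₁]
  have hrc : r.natDegree ≤ c := by omega
  rw [transform_mul q hd₁.le hrc]
  exact dvd_mul_right _ _

/-- `C a` with `a` a non-zero-divisor of `R` is cancellable in `R[X]`. [folklore] -/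
private theorem eq_zero_of_C_mul_eq_zero {a : R} (ha : a ∈ R⁰) {f : R[X]} (hf : C a * f = 0) : f = 0 := by
  ext i
  have hi := congrArg (fun g : R[X] ↦ g.coeff i) hf
  simp only [coeff_C_mul, coeff_zero] at hi
  exact (mem_nonZeroDivisors_iff_left.mp ha) _ hi

/-- The degree of `f ∘ (q·X)` is at most that of `f`. [folklore] -/
private theorem natDegree_comp_C_mul_X_le (q : R) (f : R[X]) : (f.comp (C q * X)).natDegree ≤ f.natDegree :=
  natDegree_comp_le.trans (by
    calc f.natDegree * (C q * X).natDegree ≤ f.natDegree * 1 := by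
          gcongr
          exact (natDegree_mul_le).trans (by rw [natDegree_C, zero_add]; exact natDegree_X_le)
      _ = f.natDegree := mul_one _)

/-- Core of `dvd_of_transform_dvd_transform` with the degree shift made explicit (`n₂ = n₁ + c`, nonzero cofactor). The quotient `B`
of `𝒯_{n₁+c}(h₂)` by the monic `𝒯_{n₁}(h₁)` satisfies `reflect_{2c}(B ∘ qX) = q^c·B` (cancel `q^{n₁}·𝒯_{n₁}(h₁)` from the two reflection
identities), so `B` is `q`-palindromic, `B = 𝒯_c(r)`, and `𝒯_{n₁+c}(h₂) = 𝒯_{n₁+c}(h₁ r)` forces `h₂ = h₁ r`.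
[cite: GoreskyTai2017RealStructuresOrdinary, App. §16.2 Prop. 36 «the lower half of the matrix A is nonsingular» and Lemma 37 (p0036–p0037)] -/
private theorem dvd_of_transform_eq_transform_mul [Nontrivial R] {q : R} (hq : q ∈ R⁰) {n₁ c : ℕ} {h₁ h₂ B : R[X]}
    (hm₁ : h₁.Monic) (hd₁ : h₁.natDegree = n₁) (hn₂ : h₂.natDegree ≤ n₁ + c) (hB0 : B ≠ 0)
    (hB : (∑ j ∈ Finset.range (n₁ + c + 1), C (h₂.coeff j) * X ^ (n₁ + c - j) * (X ^ 2 + C q) ^ j) =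
      (∑ j ∈ Finset.range (n₁ + 1), C (h₁.coeff j) * X ^ (n₁ - j) * (X ^ 2 + C q) ^ j) * B) :
    h₁ ∣ h₂ := by
  set p₁ : R[X] := ∑ j ∈ Finset.range (n₁ + 1), C (h₁.coeff j) * X ^ (n₁ - j) * (X ^ 2 + C q) ^ j with hp₁
  set p₂ : R[X] := ∑ j ∈ Finset.range (n₁ + c + 1), C (h₂.coeff j) * X ^ (n₁ + c - j) * (X ^ 2 + C q) ^ j with hp₂
  obtain ⟨hp₁m, hp₁d⟩ := monic_transform q n₁ hm₁ hd₁
  have hp₂d : p₂.natDegree ≤ 2 * (n₁ + c) := natDegree_transform_le_two_mul q (n₁ + c) h₂ hn₂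
  have hpal₁ : ∀ r ≤ n₁, p₁.coeff (n₁ - r) = q ^ r * p₁.coeff (n₁ + r) := fun r hr ↦ transform_pal q n₁ h₁ hr
  have hpal₂ : ∀ r ≤ n₁ + c, p₂.coeff (n₁ + c - r) = q ^ r * p₂.coeff (n₁ + c + r) := fun r hr ↦ transform_pal q (n₁ + c) h₂ hr
  -- degree of the cofactor
  have hdegB : p₂.natDegree = 2 * n₁ + B.natDegree := by rw [hB, hp₁m.natDegree_mul' hB0, hp₁d]
  have hBd : B.natDegree ≤ 2 * c := by omega
  -- the two reflection identities and multiplicativity of `reflect`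
  have href₁ := reflect_comp_C_mul_X_of_pal hp₁d.le hpal₁
  have href₂ := reflect_comp_C_mul_X_of_pal hp₂d hpal₂
  have hdc₁ : (p₁.comp (C q * X)).natDegree ≤ 2 * n₁ := (natDegree_comp_C_mul_X_le q p₁).trans hp₁d.le
  have hdcB : (B.comp (C q * X)).natDegree ≤ 2 * c := (natDegree_comp_C_mul_X_le q B).trans hBd
  have key : (p₂.comp (C q * X)).reflect (2 * (n₁ + c)) = (p₁.comp (C q * X)).reflect (2 * n₁) * (B.comp (C q * X)).reflect (2 * c) := by
    rw [hB, mul_comp, show 2 * (n₁ + c) = 2 * n₁ + 2 * c by ring, reflect_mul _ _ hdc₁ hdcB]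
  rw [href₂, href₁, hB, pow_add, map_mul] at key
  -- cancel `C(q^{n₁})` and the monic `p₁`
  have h1 : C (q ^ n₁) * (p₁ * ((B.comp (C q * X)).reflect (2 * c) - C (q ^ c) * B)) = 0 := by
    linear_combination (-1 : R[X]) * key
  have h2 : (B.comp (C q * X)).reflect (2 * c) - C (q ^ c) * B = 0 :=
    (hp₁m.mul_right_eq_zero_iff).mp (eq_zero_of_C_mul_eq_zero (pow_mem hq n₁) h1)
  have hBpal : ∀ r ≤ c, B.coeff (c - r) = q ^ r * B.coeff (c + r) := pal_of_reflect_comp_C_mul_X hq (sub_eq_zero.mp h2)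
  -- so `B` is a transform, and `𝒯` is multiplicative and injective
  obtain ⟨r, hrc, hBr⟩ := exists_eq_transform q c B hBd hBpal
  have hmul := transform_mul q hd₁.le hrc
  have heq : p₂ = ∑ j ∈ Finset.range (n₁ + c + 1), C ((h₁ * r).coeff j) * X ^ (n₁ + c - j) * (X ^ 2 + C q) ^ j := by
    rw [hmul, ← hp₁, ← hBr, hB]
  exact ⟨r, transform_injective q (n₁ + c) hn₂ ((natDegree_mul_le).trans (Nat.add_le_add hd₁.le hrc)) heq⟩

/-- ★★ **`𝒯` REFLECTS divisibility.** `q` a non-zero-divisor, `h₁` monic of degree `n₁`, `deg h₂ ≤ n₂`: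
**`𝒯_{q,n₁}(h₁) ∣ 𝒯_{q,n₂}(h₂) ⟹ h₁ ∣ h₂`** (a factor of a `q`-palindromic polynomial complementary to a monic `q`-palindromic factor is
`q`-palindromic — Goresky–Tai's Lemma 37 run backwards — and `𝒯` is multiplicative and injective). For Weil `q`-polynomials: the real Weil
polynomial of an isogeny factor divides the real Weil polynomial. [cite: GoreskyTai2017RealStructuresOrdinary, App. §16.2 Prop. 36 and Lemma 37 (p0036–p0037)] -/
theorem dvd_of_transform_dvd_transform {q : R} (hq : q ∈ R⁰) {n₁ n₂ : ℕ} {h₁ h₂ : R[X]} (hm₁ : h₁.Monic) (hd₁ : h₁.natDegree = n₁)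
    (hn₂ : h₂.natDegree ≤ n₂)
    (hdvd : (∑ j ∈ Finset.range (n₁ + 1), C (h₁.coeff j) * X ^ (n₁ - j) * (X ^ 2 + C q) ^ j) ∣
      ∑ j ∈ Finset.range (n₂ + 1), C (h₂.coeff j) * X ^ (n₂ - j) * (X ^ 2 + C q) ^ j) :
    h₁ ∣ h₂ := by
  rcases subsingleton_or_nontrivial R with hR | hR
  · exact ⟨0, Subsingleton.elim _ _⟩
  obtain ⟨B, hB⟩ := hdvd
  by_cases hB0 : B = 0
  · -- `𝒯(h₂) = 0`, so `h₂ = 0`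
    rw [hB0, mul_zero] at hB
    have h20 : h₂ = 0 :=
      transform_injective q n₂ hn₂ (by rw [natDegree_zero]; exact Nat.zero_le _) (by rw [hB, transform_zero])
    rw [h20]; exact dvd_zero _
  obtain ⟨hp₁m, hp₁d⟩ := monic_transform q n₁ hm₁ hd₁
  have hp₂d := natDegree_transform_le_two_mul q n₂ h₂ hn₂
  have hdegB := congrArg natDegree hB
  rw [hp₁m.natDegree_mul' hB0, hp₁d] at hdegB
  have hle : n₁ ≤ n₂ := by omega
  obtain ⟨c, rfl⟩ := Nat.exists_eq_add_of_le hle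
  exact dvd_of_transform_eq_transform_mul hq hm₁ hd₁ hn₂ hB0 hB

/-- ★★ **`𝒯_{q,n₁}(h₁) ∣ 𝒯_{q,n₂}(h₂) ⟺ h₁ ∣ h₂`** (`q` a non-zero-divisor, `h₁` monic of degree `n₁`, `deg h₂ ≤ n₂`, `n₁ ≤ n₂`).
[cite: GoreskyTai2017RealStructuresOrdinary, App. §16.2 Prop. 36 and Lemma 37 (p0036–p0037)] -/
theorem transform_dvd_transform_iff {q : R} (hq : q ∈ R⁰) {n₁ n₂ : ℕ} {h₁ h₂ : R[X]} (hm₁ : h₁.Monic) (hd₁ : h₁.natDegree = n₁)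
    (hn₂ : h₂.natDegree ≤ n₂) (hle : n₁ ≤ n₂) :
    (∑ j ∈ Finset.range (n₁ + 1), C (h₁.coeff j) * X ^ (n₁ - j) * (X ^ 2 + C q) ^ j) ∣
        ∑ j ∈ Finset.range (n₂ + 1), C (h₂.coeff j) * X ^ (n₂ - j) * (X ^ 2 + C q) ^ j ↔ h₁ ∣ h₂ :=
  ⟨dvd_of_transform_dvd_transform hq hm₁ hd₁ hn₂, transform_dvd_transform_of_dvd q hm₁ hd₁ hn₂ hle⟩

end Transform

/-! ## §2 The twist-zero form in the Iwasawa variable `T = X − 1` (any domain) -/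

section TwistZero

open Polynomial

variable {R : Type*} [CommRing R]

/-- `𝒯'_m(h)(T) := ∑ b_j (1+T)^{m−j}((1+T)²+1)^j` composed with `T = X − 1` is the transform `𝒯_{1,m}(h)(X)`. [folklore] -/
theorem twistForm_comp_X_sub_one (h : R[X]) (m : ℕ) :
    (∑ j ∈ Finset.range (m + 1), C (h.coeff j) * (X + C 1) ^ (m - j) * ((X + C 1) ^ 2 + C 1) ^ j).comp (X - C 1) =
      ∑ j ∈ Finset.range (m + 1), C (h.coeff j) * X ^ (m - j) * (X ^ 2 + C 1) ^ j := by
  simp only [Polynomial.sum_comp, Polynomial.mul_comp, Polynomial.C_comp, Polynomial.pow_comp, Polynomial.add_comp, Polynomial.X_comp,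
    sub_add_cancel]

/-- Conversely `𝒯_{1,m}(h)(X) ∘ (X + 1) = 𝒯'_m(h)(T)`. [folklore] -/
theorem transform_comp_X_add_one (h : R[X]) (m : ℕ) :
    (∑ j ∈ Finset.range (m + 1), C (h.coeff j) * X ^ (m - j) * (X ^ 2 + C 1) ^ j).comp (X + C 1) =
      ∑ j ∈ Finset.range (m + 1), C (h.coeff j) * (X + C 1) ^ (m - j) * ((X + C 1) ^ 2 + C 1) ^ j := by
  simp only [Polynomial.sum_comp, Polynomial.mul_comp, Polynomial.C_comp, Polynomial.pow_comp, Polynomial.add_comp, Polynomial.X_comp]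

/-- Divisibility is preserved by composition with a polynomial (`comp` is a ring map on the left argument). [folklore] -/
private theorem comp_dvd_comp {A B : R[X]} (hAB : A ∣ B) (g : R[X]) : A.comp g ∣ B.comp g := by
  obtain ⟨Q, rfl⟩ := hAB
  exact ⟨Q.comp g, by rw [mul_comp]⟩

/-- **The value of `𝒯'_m(h)` at the twist point `T = −2` is `(−1)^m·h(−2)`** (`x = −1`, `x + x⁻¹ = −2`; `…HalfDescentValues.eval_neg_two_eq`).
[cite: GoreskyTai2017RealStructuresOrdinary, App. §16.1–§16.2 «p(x) = xⁿ h(x + q/x)» (p0036)] -/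
theorem eval_neg_two_twistForm {h : R[X]} {m : ℕ} (hn : h.natDegree ≤ m) :
    (∑ j ∈ Finset.range (m + 1), C (h.coeff j) * (X + C 1) ^ (m - j) * ((X + C 1) ^ 2 + C 1) ^ j).eval (-2) = (-1) ^ m * h.eval (-2) :=
  Summit.BirchSwinnertonDyer.BirchSwinnertonDyer.Theorems.AlignedTransportAtTwoHalfDescentValues.eval_neg_two_eq hn
    (twistForm_comp_X_sub_one h m)

/-- `𝒯'_m(h)` is monic of degree `2m` for `h` monic of degree `m`. [cite: GoreskyTai2017RealStructuresOrdinary, App. §16.2 «a monic polynomial p(x) = x^{2n} + …» (p0036)] -/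
theorem monic_twistForm {h : R[X]} {m : ℕ} (hm : h.Monic) (hd : h.natDegree = m) :
    (∑ j ∈ Finset.range (m + 1), C (h.coeff j) * (X + C 1) ^ (m - j) * ((X + C 1) ^ 2 + C 1) ^ j).Monic ∧
      (∑ j ∈ Finset.range (m + 1), C (h.coeff j) * (X + C 1) ^ (m - j) * ((X + C 1) ^ 2 + C 1) ^ j).natDegree = 2 * m := by
  rcases subsingleton_or_nontrivial R with hR | hR
  · have h0 : m = 0 := by rw [← hd]; exact natDegree_of_subsingleton
    subst h0
    exact ⟨monic_of_subsingleton _, natDegree_of_subsingleton⟩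
  obtain ⟨hmon, hdeg⟩ := monic_transform (1 : R) m hm hd
  rw [← transform_comp_X_add_one]
  refine ⟨hmon.comp (monic_X_add_C 1) (by rw [natDegree_X_add_C]; exact one_ne_zero), ?_⟩
  rw [natDegree_comp_eq_of_mul_ne_zero (by rw [hmon.leadingCoeff, (monic_X_add_C (1 : R)).leadingCoeff, one_pow, one_mul]; exact one_ne_zero),
    natDegree_X_add_C, mul_one, hdeg]

variable [IsDomain R]

/-- ★★ **The twist-zero form REFLECTS divisibility.** Over a domain: `h₁, h₂` monic of degrees `m₁, m₂`, `h₁(−2) ≠ 0` (i.e. `k₁` is the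
full order of `(T+2)^{k₁}𝒯'(h₁)` at `T = −2`). If **`(T+2)^{k₁}·𝒯'_{m₁}(h₁) ∣ (T+2)^{k₂}·𝒯'_{m₂}(h₂)`** then **`h₁ ∣ h₂`** and
`k₁ ≤ k₂ + ord_{T=−2} 𝒯'_{m₂}(h₂)` (compare orders at `−2`, peel the excess `(T+2)`-power off the cofactor, cancel, and apply §1 at `q = 1`).
[cite: GoreskyTai2017RealStructuresOrdinary, App. §16.2 Prop. 36 and Lemma 37 (p0036–p0037)] [cite: MazurTateTeitelbaum1986Invent, Ch. I §17] -/
theorem dvd_of_twistZero_mul_dvd {h₁ h₂ : R[X]} {m₁ m₂ k₁ k₂ : ℕ} (hm₁ : h₁.Monic) (hd₁ : h₁.natDegree = m₁) (hm₂ : h₂.Monic)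
    (hd₂ : h₂.natDegree = m₂) (hroot : h₁.eval (-2) ≠ 0)
    (hdvd : (X + C 2) ^ k₁ * ∑ j ∈ Finset.range (m₁ + 1), C (h₁.coeff j) * (X + C 1) ^ (m₁ - j) * ((X + C 1) ^ 2 + C 1) ^ j ∣
      (X + C 2) ^ k₂ * ∑ j ∈ Finset.range (m₂ + 1), C (h₂.coeff j) * (X + C 1) ^ (m₂ - j) * ((X + C 1) ^ 2 + C 1) ^ j) :
    h₁ ∣ h₂ ∧ k₁ ≤ k₂ + (∑ j ∈ Finset.range (m₂ + 1), C (h₂.coeff j) * (X + C 1) ^ (m₂ - j) * ((X + C 1) ^ 2 + C 1) ^ j).rootMultiplicity (-2) := by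
  set A₁ : R[X] := ∑ j ∈ Finset.range (m₁ + 1), C (h₁.coeff j) * (X + C 1) ^ (m₁ - j) * ((X + C 1) ^ 2 + C 1) ^ j with hA₁
  set A₂ : R[X] := ∑ j ∈ Finset.range (m₂ + 1), C (h₂.coeff j) * (X + C 1) ^ (m₂ - j) * ((X + C 1) ^ 2 + C 1) ^ j with hA₂
  have hXC : (X + C (2 : R)) = X - C (-2) := by rw [map_neg, sub_neg_eq_add]
  have hA₁m : A₁.Monic := (monic_twistForm hm₁ hd₁).1
  have hA₂m : A₂.Monic := (monic_twistForm hm₂ hd₂).1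
  have hLk : ∀ k : ℕ, ((X + C (2 : R)) ^ k).rootMultiplicity (-2) = k := fun k ↦ by rw [hXC]; exact rootMultiplicity_X_sub_C_pow (-2) k
  have hLne : ∀ k : ℕ, (X + C (2 : R)) ^ k ≠ 0 := fun k ↦ pow_ne_zero k (monic_X_add_C 2).ne_zero
  -- order of `A₁` at `−2` is zero
  have hA₁r : A₁.rootMultiplicity (-2) = 0 := by
    refine rootMultiplicity_eq_zero ?_
    rw [IsRoot.def, hA₁, eval_neg_two_twistForm hd₁.le]
    exact mul_ne_zero (pow_ne_zero _ (neg_ne_zero.mpr one_ne_zero)) hroot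
  obtain ⟨Q, hQ⟩ := hdvd
  have hBne : (X + C 2) ^ k₂ * A₂ ≠ 0 := mul_ne_zero (hLne k₂) hA₂m.ne_zero
  have hQne : Q ≠ 0 := fun h0 ↦ hBne (by rw [hQ, h0, mul_zero])
  -- compare orders at `−2`
  have hordB : ((X + C 2) ^ k₂ * A₂).rootMultiplicity (-2) = k₂ + A₂.rootMultiplicity (-2) := by
    rw [rootMultiplicity_mul hBne, hLk]
  have hordAQ : ((X + C 2) ^ k₁ * A₁ * Q).rootMultiplicity (-2) = k₁ + Q.rootMultiplicity (-2) := by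
    rw [rootMultiplicity_mul (by rw [← hQ]; exact hBne), rootMultiplicity_mul (mul_ne_zero (hLne k₁) hA₁m.ne_zero), hLk, hA₁r, add_zero]
  have hord : k₂ + A₂.rootMultiplicity (-2) = k₁ + Q.rootMultiplicity (-2) := by rw [← hordB, hQ, hordAQ]
  refine ⟨?_, by omega⟩
  -- peel `(T+2)^ρ` off `Q` and cancel `(T+2)^{k₂}`
  set ρ : ℕ := Q.rootMultiplicity (-2) with hρ
  have hQfac : Q = (X + C 2) ^ ρ * (Q /ₘ (X + C 2) ^ ρ) := by
    rw [hρ, hXC]; exact (pow_mul_divByMonic_rootMultiplicity_eq Q (-2)).symm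
  have hsplit : (X + C (2 : R)) ^ k₁ * (X + C 2) ^ ρ = (X + C 2) ^ k₂ * (X + C 2) ^ A₂.rootMultiplicity (-2) := by
    rw [← pow_add, ← pow_add, ← hord]
  have hcancel : A₂ = (X + C 2) ^ A₂.rootMultiplicity (-2) * A₁ * (Q /ₘ (X + C 2) ^ ρ) := by
    refine mul_left_cancel₀ (hLne k₂) ?_
    calc (X + C 2) ^ k₂ * A₂ = (X + C 2) ^ k₁ * A₁ * Q := hQ
      _ = (X + C 2) ^ k₁ * (X + C 2) ^ ρ * A₁ * (Q /ₘ (X + C 2) ^ ρ) := by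
          conv_lhs => rw [hQfac]
          ring
      _ = (X + C 2) ^ k₂ * ((X + C 2) ^ A₂.rootMultiplicity (-2) * A₁ * (Q /ₘ (X + C 2) ^ ρ)) := by
          rw [hsplit]
          ring
  have hA : A₁ ∣ A₂ := by
    refine ⟨(X + C 2) ^ A₂.rootMultiplicity (-2) * (Q /ₘ (X + C 2) ^ ρ), ?_⟩
    calc A₂ = (X + C 2) ^ A₂.rootMultiplicity (-2) * A₁ * (Q /ₘ (X + C 2) ^ ρ) := hcancel
      _ = A₁ * ((X + C 2) ^ A₂.rootMultiplicity (-2) * (Q /ₘ (X + C 2) ^ ρ)) := by ring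
  -- back to the transform in `X = T + 1`, then §1 at `q = 1`
  have hT := comp_dvd_comp hA (X - C 1)
  rw [hA₁, hA₂, twistForm_comp_X_sub_one, twistForm_comp_X_sub_one] at hT
  exact dvd_of_transform_dvd_transform (one_mem _) hm₁ hd₁ hd₂.le hT

/-- **Normalised form**: if moreover `h₂(−2) ≠ 0` (so `k₂` is the full order at `−2` too) then `h₁ ∣ h₂` and **`k₁ ≤ k₂`**.
[cite: GoreskyTai2017RealStructuresOrdinary, App. §16.2 Prop. 36 and Lemma 37 (p0036–p0037)] [cite: MazurTateTeitelbaum1986Invent, Ch. I §17] -/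
theorem dvd_and_le_of_twistZero_mul_dvd {h₁ h₂ : R[X]} {m₁ m₂ k₁ k₂ : ℕ} (hm₁ : h₁.Monic) (hd₁ : h₁.natDegree = m₁) (hm₂ : h₂.Monic)
    (hd₂ : h₂.natDegree = m₂) (hroot₁ : h₁.eval (-2) ≠ 0) (hroot₂ : h₂.eval (-2) ≠ 0)
    (hdvd : (X + C 2) ^ k₁ * ∑ j ∈ Finset.range (m₁ + 1), C (h₁.coeff j) * (X + C 1) ^ (m₁ - j) * ((X + C 1) ^ 2 + C 1) ^ j ∣
      (X + C 2) ^ k₂ * ∑ j ∈ Finset.range (m₂ + 1), C (h₂.coeff j) * (X + C 1) ^ (m₂ - j) * ((X + C 1) ^ 2 + C 1) ^ j) :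
    h₁ ∣ h₂ ∧ k₁ ≤ k₂ := by
  obtain ⟨hdiv, hk⟩ := dvd_of_twistZero_mul_dvd hm₁ hd₁ hm₂ hd₂ hroot₁ hdvd
  have h0 : (∑ j ∈ Finset.range (m₂ + 1), C (h₂.coeff j) * (X + C 1) ^ (m₂ - j) * ((X + C 1) ^ 2 + C 1) ^ j).rootMultiplicity (-2) = 0 := by
    refine rootMultiplicity_eq_zero ?_
    rw [IsRoot.def, eval_neg_two_twistForm hd₂.le]
    exact mul_ne_zero (pow_ne_zero _ (neg_ne_zero.mpr one_ne_zero)) hroot₂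
  exact ⟨hdiv, by rw [h0, add_zero] at hk; exact hk⟩

omit [IsDomain R] in
/-- **Converse**: `h₁ ∣ h₂` (monic, degrees `m₁ ≤ m₂`) and `k₁ ≤ k₂` ⟹ `(T+2)^{k₁}𝒯'_{m₁}(h₁) ∣ (T+2)^{k₂}𝒯'_{m₂}(h₂)`.
[cite: GoreskyTai2017RealStructuresOrdinary, App. §16.2 Prop. 36 and proof of Lemma 37 (p0036–p0037)] -/
theorem twistZero_mul_dvd_of_dvd {h₁ h₂ : R[X]} {m₁ m₂ k₁ k₂ : ℕ} (hm₁ : h₁.Monic) (hd₁ : h₁.natDegree = m₁) (hn₂ : h₂.natDegree ≤ m₂)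
    (hle : m₁ ≤ m₂) (hk : k₁ ≤ k₂) (hdvd : h₁ ∣ h₂) :
    (X + C 2) ^ k₁ * ∑ j ∈ Finset.range (m₁ + 1), C (h₁.coeff j) * (X + C 1) ^ (m₁ - j) * ((X + C 1) ^ 2 + C 1) ^ j ∣
      (X + C 2) ^ k₂ * ∑ j ∈ Finset.range (m₂ + 1), C (h₂.coeff j) * (X + C 1) ^ (m₂ - j) * ((X + C 1) ^ 2 + C 1) ^ j := by
  have hT := comp_dvd_comp (transform_dvd_transform_of_dvd (1 : R) hm₁ hd₁ hn₂ hle hdvd) (X + C 1)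
  rw [transform_comp_X_add_one, transform_comp_X_add_one] at hT
  exact mul_dvd_mul (pow_dvd_pow _ hk) hT

end TwistZero

end Summit.BirchSwinnertonDyer.BirchSwinnertonDyer.Theorems.AlignedTransportAtTwoHalfDescentDivisibility

end
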